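import Literature.AlgebraicGeometry.Tropical.CellularTropicalHomology
import Literature.AlgebraicGeometry.HodgeTheory.DiagonalCharacterEigenspace
import Literature.AlgebraicGeometry.HodgeTheory.FermatDiagonalAction
import Literature.AlgebraicGeometry.HodgeTheory.FermatHodgeCharacters
import Literature.AlgebraicGeometry.HodgeTheory.HypersurfaceComplexPoints
import Literature.AlgebraicTopology.SingularHomology.CupProduct
import HarnessLib

/-!
# Sparse Fermat perturbations: the equisingular family `Σ xᵢᵈ + Σ_{b ∈ B} c_b x^b`, its diagonal
symmetry group, invariant characters, and tropicalisation

Layer `Literature/AlgebraicGeometry/HodgeTheory`. Real definitions (no facts) attached to a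
**sparse Fermat datum** `𝔇 = (p, d, B)`: `p ≥ 2`, `d ≥ 3`, `B` a finite set of exponent vectors of
degree `d` in `2p + 2` variables, none a pure power (`SparseFermat.Datum`). Shioda's analysis of the
Fermat variety `X_d^{2p} : Σ xᵢᵈ = 0` under `μ_d^{2p+2}` (PJA 55A (1979) §1, §4; Math. Ann. 245
(1979) Thm. I) is the source of every notion:

* `form 𝔇 c = Σᵢ xᵢᵈ + Σ_{b ∈ B} c_b x^b` and the hypersurface `variety 𝔇 c = V₊(form) ⊆ ℙ^{2p+1}_ℂ`
  (the tree's reduced `Motives.SmoothHypersurface.hypersurface`);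
* `group 𝔇 = A_B = {ζ ∈ μ_d^{2p+2} | ζ^b = 1 (b ∈ B)}`, the diagonal symmetries surviving the
  perturbation (`group_le_diagonalStabilizer`, PROVED: `A_B` fixes `form 𝔇 c` for every `c`), finite
  (`≤ fermatGroup`), and the projector `proj 𝔇 c` onto the `A_B`-invariants of `H^{2p}(X_c(ℂ); ℂ)`
  (the tree's `eigenProjector` at the trivial character);
* `charLattice 𝔇 = Λ_B ⊆ (ℤ/d)^{2p+2}`, the characters generated by `B mod d` — by duality exactly the
  characters of `μ_d^{2p+2}` trivial on `A_B`; `invariantRank 𝔇 = 1 + #(𝔄 ∩ Λ_B)` (Shioda's admissible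
  characters `𝔄`, file `FermatHodgeCharacters`), the dimension `dim H^{2p}(X_d(ℂ))^{A_B}` predicted by
  Shioda's character decomposition (`h^p` and one line `V(α)` per admissible invariant character);
  `IsPure 𝔇`: every admissible character in `Λ_B` is a Hodge character (all of `H^{2p}_prim(X_d)^{A_B}`
  is of type `(p, p)`);
* `exponents 𝔇 = S = {d eᵢ} ∪ B`, heights `h : B → ℝ` (extended by `0` on the `d eᵢ`), the extended
  tropical hypersurface `tropicalVariety 𝔇 h ⊆ 𝕋ℙ^{2p+1}` of `min_{s ∈ S}(ht s + ⟨s, u⟩)`,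
  `IsUnimodularHeight` (the regular subdivision of `(S, h)` is a triangulation unimodular for
  `ℤ⟨S - S⟩`, i.e. the tropical hypersurface is smooth for the dual lattice) and `IsGenericHeight`
  (`1, (h_b)_b` linearly independent over `ℚ`);
* `tropCoord v z`, `tropicalization 𝔇 c v Z`: the coordinatewise valuation image
  `(−log v(zᵢ))ᵢ ∈ 𝕋ℙ^{2p+1}` of the complex points over a subset `Z ⊆ X_c` (homogeneous coordinates
  through the tree's `hypersurfacePoint`), saturated under translation and closed up — the
  tropicalisation of `Z` with respect to a rank-one valuation `v` on `ℂ` (Maclagan–Sturmfels §3.2, §6.2);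
* `cupRank X k W`: the rank of the cup product `W × W → H^{2k}(X(ℂ); ℂ)` restricted to a subspace
  `W ⊆ Hᵏ(X(ℂ); ℂ)` (rank of `w ↦ (w' ↦ w ∪ w')`), an orientation-free rendering of the rank of the
  intersection Gram matrix of a family spanning `W` (the tree fixes no trace `H^{top} ≅ ℂ`).

NOT here: any statement about these objects (the character decomposition of `H^{2p}(X_c)`, Hodge
types of invariant classes, smoothness of `X_c` for generic `c`, existence of valuations with
prescribed values, tropical comparison theorems) — those are facts or route items elsewhere.

References: T. Shioda, Proc. Japan Acad. 55A (1979) §1, §4 [Shioda1979PJA]; T. Shioda, Math. Ann.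
245 (1979) [Shioda1979HodgeFermat]; D. Maclagan, B. Sturmfels, GSM 161, §2.3, §3.1–3.2, §6.2
[MaclaganSturmfels2015]; N. Katz, Progr. Math. 270 (2009) §3 [Katz2009].
-/

noncomputable section

open scoped Classical
open MvPolynomial

namespace Literature.AlgebraicGeometry.HodgeTheory

/-- The rank of the cup product pairing `W × W → H^{k+k}(X(ℂ); ℂ)`, `(w, w') ↦ w ∪ w'`, on a
subspace
`W ⊆ Hᵏ(X(ℂ); ℂ)`: the rank of the linear map `w ↦ (w ∪ ·)|_W`. For `X(ℂ)` connected closed oriented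
of real dimension `2k` this is the rank of the Gram matrix `(⟨wᵢ ∪ wⱼ, [X]⟩)` of any family spanning
`W`. [cite: Hatcher2002, §3.3 p. 249 the pairing of Prop. 3.38] -/
def cupRank (X : Motives.SchemeOver ℂ) (k : ℕ) (W : Submodule ℂ (complexBetti X k)) : ℕ :=
  Module.finrank ℂ (LinearMap.range
    ((Literature.AlgebraicTopology.SingularHomology.cupProduct (R := ℂ)
      (X := Motives.ComplexPoints X) (rfl : k + k = k + k)).domRestrict₁₂ W W))

namespace SparseFermat

/-- A **sparse Fermat datum** `𝔇 = (p, d, B)`: half-dimension `p ≥ 2`, degree `d ≥ 3`, and a finite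
set
`B` of exponent vectors of degree `d` in `2p + 2` variables with at least two variables each (no pure
powers `d eᵢ`). [cite: Shioda1979PJA, §1] -/
structure Datum where
  /-- half the dimension of the hypersurface `X ⊆ ℙ^{2p+1}` -/
  p : ℕ
  /-- the degree -/
  d : ℕ
  /-- the perturbing monomials -/
  B : Finset (Fin (2 * p + 2) →₀ ℕ)
  two_le_p : 2 ≤ p
  three_le_d : 3 ≤ d
  degree_eq : ∀ b ∈ B, (∑ i, b i) = d
  two_le_card_support : ∀ b ∈ B, 2 ≤ b.support.card

namespace Datum

variable (𝔇 : Datum)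

/-- `d ≠ 0` (from `3 ≤ d`), for `ZMod d` finiteness. [folklore] -/
instance instNeZeroD : NeZero 𝔇.d := ⟨by have := 𝔇.three_le_d; omega⟩

/-! ### The family and its symmetry group -/

/-- The form `Σᵢ xᵢᵈ + Σ_{b ∈ B} c_b x^b`. [cite: Shioda1979PJA, §1] -/
def form (c : ↥𝔇.B → ℂ) : MvPolynomial (Fin (2 * 𝔇.p + 2)) ℂ :=
  ∑ i, X i ^ 𝔇.d + ∑ b : ↥𝔇.B, C (c b) * monomial b.1 1

/-- The hypersurface `X_c = V₊(Σ xᵢᵈ + Σ c_b x^b) ⊆ ℙ^{2p+1}_ℂ` (reduced structure). [cite: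
Shioda1979PJA, §1] -/
abbrev variety (c : ↥𝔇.B → ℂ) : Motives.SchemeOver ℂ :=
  Motives.SmoothHypersurface.hypersurface (𝔇.form c)

/-- The character `ζ ↦ ζ^b = ∏ ζᵢ^{bᵢ}` of `(ℂˣ)^{2p+2}`. [cite: Shioda1979PJA, §4] -/
def monomialChar (b : Fin (2 * 𝔇.p + 2) →₀ ℕ) : (Fin (2 * 𝔇.p + 2) → ℂˣ) →* ℂˣ where
  toFun a := ∏ i, a i ^ (b i)
  map_one' := by simp
  map_mul' a a' := by simp [mul_pow, Finset.prod_mul_distrib]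

/-- `monomialChar b ζ = ∏ ζᵢ^{bᵢ}`. [folklore] -/
@[simp]
theorem monomialChar_apply (b : Fin (2 * 𝔇.p + 2) →₀ ℕ) (a : Fin (2 * 𝔇.p + 2) → ℂˣ) :
    𝔇.monomialChar b a = ∏ i, a i ^ (b i) := rfl

/-- The diagonal symmetry group `A_B = {ζ ∈ μ_d^{2p+2} | ζ^b = 1 for all b ∈ B}` of the family.
[cite: Shioda1979PJA, §4] [cite: Katz2009, §3] -/
def group : Subgroup (Fin (2 * 𝔇.p + 2) → ℂˣ) :=
  fermatGroup (2 * 𝔇.p) 𝔇.d ⊓ ⨅ b ∈ 𝔇.B, (𝔇.monomialChar b).ker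

/-- `A_B ≤ μ_d^{2p+2}`. [folklore] -/
theorem group_le_fermatGroup : 𝔇.group ≤ fermatGroup (2 * 𝔇.p) 𝔇.d := inf_le_left

/-- `A_B` is finite. [folklore] -/
instance instFiniteGroup : Finite ↥𝔇.group :=
  Finite.of_injective _ (Subgroup.inclusion_injective 𝔇.group_le_fermatGroup)

/-- (noncomputable `Fintype` on `A_B`, for the averaging projector). [folklore] -/
instance instFintypeGroup : Fintype ↥𝔇.group := Fintype.ofFinite _

/-- **`A_B` fixes the form `Σ xᵢᵈ + Σ c_b x^b`** for every `c`: `(ζᵢxᵢ)ᵈ = xᵢᵈ` and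
`c_b (ζx)^b = c_b ζ^b x^b = c_b x^b`. [cite: Shioda1979PJA, §4] -/
theorem group_le_diagonalStabilizer (c : ↥𝔇.B → ℂ) :
    𝔇.group ≤ diagonalStabilizer (𝔇.form c) := by
  intro a ha
  have ha1 : ∀ i, ((a i : ℂˣ) : ℂ) ^ 𝔇.d = 1 := fun i ↦ by
    rw [← Units.val_pow_eq_pow_val, mem_fermatGroup_iff.mp (Subgroup.mem_inf.mp ha).1 i,
      Units.val_one]
  have ha2 : ∀ b ∈ 𝔇.B, ∏ i, ((a i : ℂˣ) : ℂ) ^ (b i) = 1 := fun b hb ↦ by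
    have h := (Subgroup.mem_inf.mp ha).2
    rw [Subgroup.mem_iInf] at h
    have h' := h b
    rw [Subgroup.mem_iInf] at h'
    have h'' : a ∈ (𝔇.monomialChar b).ker := h' hb
    rw [MonoidHom.mem_ker, monomialChar_apply] at h''
    have h3 := congrArg (fun u : ℂˣ ↦ (u : ℂ)) h''
    simpa using h3
  rw [mem_diagonalStabilizer_iff, form, map_add, map_sum, map_sum]
  congr 1
  · refine Finset.sum_congr rfl fun i _ ↦ ?_
    rw [map_pow, aeval_X, diagonalSubst_apply, mul_pow, ← map_pow, ha1 i, map_one, one_mul]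
  · refine Finset.sum_congr rfl fun b _ ↦ ?_
    rw [map_mul, aeval_C, algebraMap_eq, aeval_monomial, map_one, one_mul, monomial_eq, C_1,
      one_mul]
    congr 1
    rw [Finsupp.prod_fintype _ _ (by simp), Finsupp.prod_fintype _ _ (by simp)]
    simp_rw [diagonalSubst_apply, mul_pow, Finset.prod_mul_distrib, ← map_pow, ← map_prod,
      ha2 b.1 b.2, map_one, one_mul]

/-- The projector onto the `A_B`-invariants of `H^{2p}(X_c(ℂ); ℂ)` (averaging over `A_B`; the tree's
`eigenProjector` at the trivial character). [cite: SerreLinearRepresentations1977, §2.6 Thm. 8] -/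
def proj (c : ↥𝔇.B → ℂ) : Module.End ℂ (complexBetti (𝔇.variety c) (2 * 𝔇.p)) :=
  eigenProjector (𝔇.form c) (1 : ↥𝔇.group →* ℂˣ) (2 * 𝔇.p) (𝔇.group_le_diagonalStabilizer c)

/-! ### Invariant characters -/

/-- `Λ_B ⊆ (ℤ/d)^{2p+2}`: the subgroup generated by the exponent vectors `b mod d`, `b ∈ B` — the
characters of `μ_d^{2p+2}` trivial on `A_B`. [cite: Shioda1979PJA, §4] -/
def charLattice : AddSubgroup (Fin (2 * 𝔇.p + 2) → ZMod 𝔇.d) :=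
  AddSubgroup.closure (Set.range fun b : ↥𝔇.B ↦ fun i ↦ ((b.1 i : ℕ) : ZMod 𝔇.d))

/-- `m(𝔇) = 1 + #(𝔄 ∩ Λ_B)`: one for the class `hᵖ` plus one for each admissible character (Shioda's
`𝔄`, indexing the lines `V(α)` of `H^{2p}_prim(X_d)`) trivial on `A_B` — the dimension of the
`A_B`-invariants of `H^{2p}` of a member of the family. [cite: Shioda1979PJA, §4] [cite:
Shioda1979HodgeFermat, Thm. I] -/
def invariantRank : ℕ :=
  1 + Nat.card {α : Fin (2 * 𝔇.p + 2) → ZMod 𝔇.d //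
    FermatCharacter.IsAdmissible α ∧ α ∈ 𝔇.charLattice}

/-- `𝔇` is **pure**: every admissible character trivial on `A_B` is a Hodge character, i.e. the
invariant primitive cohomology `H^{2p}_prim(X_d)^{A_B}` is entirely of type `(p, p)`.
[cite: Shioda1979PJA, §1 eq. (2) and §4] -/
def IsPure (𝔇 : Datum) : Prop :=
  ∀ α : Fin (2 * 𝔇.p + 2) → ZMod 𝔇.d, FermatCharacter.IsAdmissible α → α ∈ 𝔇.charLattice →
    FermatCharacter.IsHodge α

/-! ### Heights and the tropical hypersurface -/

/-- The exponent set `S = {d eᵢ} ∪ B` of the family. [cite: MaclaganSturmfels2015, §3.1] -/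
def exponents : Finset (Fin (2 * 𝔇.p + 2) →₀ ℕ) :=
  (Finset.univ.image fun i ↦ Finsupp.single i 𝔇.d) ∪ 𝔇.B

/-- Heights `h : B → ℝ` extended by `0` to all exponents (the valuations of the coefficients
`1, c_b`). [cite: MaclaganSturmfels2015, §3.1] -/
def heightFn (h : ↥𝔇.B → ℝ) : (Fin (2 * 𝔇.p + 2) →₀ ℕ) → ℝ :=
  fun s ↦ if hs : s ∈ 𝔇.B then h ⟨s, hs⟩ else 0

/-- The extended tropical hypersurface `X̄_h ⊆ 𝕋ℙ^{2p+1}` of `min_{s ∈ S} (ht s + ⟨s, u⟩)`.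
[cite: MaclaganSturmfels2015, §3.1 and §6.2] -/
def tropicalVariety (h : ↥𝔇.B → ℝ) : Set (Tropical.TropPoint (2 * 𝔇.p + 2)) :=
  Tropical.tropHypersurface 𝔇.exponents (𝔇.heightFn h)

/-- The heights lie in a unimodular chamber: the regular subdivision of `(S, h)` is a triangulation
unimodular for `ℤ⟨S - S⟩` (the tropical hypersurface is smooth for the dual lattice).
[cite: MaclaganSturmfels2015, §2.3 and §4.5] -/
def IsUnimodularHeight (h : ↥𝔇.B → ℝ) : Prop :=
  Tropical.RegularUnimodular 𝔇.exponents (𝔇.heightFn h)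

/-- Generic heights: `1` and the `h_b` are linearly independent over `ℚ`. [folklore] -/
def IsGenericHeight (h : ↥𝔇.B → ℝ) : Prop :=
  LinearIndependent ℚ fun o : Option ↥𝔇.B ↦ (o.elim (1 : ℝ) h : ℝ)

/-! ### Tropicalisation of subsets along a valuation -/

/-- Tropical coordinates `(−log v(zᵢ))ᵢ` of a vector, `+∞` where `zᵢ = 0`. [cite:
MaclaganSturmfels2015, §3.2] -/
def tropCoord {N : ℕ} (v : Valuation ℂ NNReal) (z : Fin N → ℂ) : Fin N → EReal :=
  fun i ↦ if z i = 0 then ⊤ else ((-Real.log ((v (z i) : NNReal) : ℝ) : ℝ) : EReal)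

/-- The tropicalisation along `v` of the complex points of `X_c` lying over `Z ⊆ X_c`: the closure
in
`𝕋ℙ^{2p+1}` of the translation-saturated set of their tropical coordinate vectors.
[cite: MaclaganSturmfels2015, §3.2 and §6.2] -/
def tropicalization (c : ↥𝔇.B → ℂ) (v : Valuation ℂ NNReal) (Z : Set (𝔇.variety c).left) :
    Set (Tropical.TropPoint (2 * 𝔇.p + 2)) :=
  closure {u | ∃ (P : Motives.ComplexPoints (𝔇.variety c)) (t : ℝ), P.pt ∈ Z ∧
    ∀ i, u.1 i = tropCoord v (Projectivization.rep
      (hypersurfacePoint (Motives.SmoothHypersurface.hypersurfaceι (𝔇.form c)) P)) i + (t : EReal)}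

end Datum

end SparseFermat

end Literature.AlgebraicGeometry.HodgeTheory

end
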